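import Summits.HodgeConjecture.HodgeConjecture.Theorems.SplitImpliesAllNonsplitCellsConnectedOfJ1
import Summits.HodgeConjecture.HodgeConjecture.Theorems.SplitImpliesAllTypeIIAnchorGerm
import Literature.AlgebraicGeometry.HodgeTheory.WeilSurfaceCMSquareAlgebraic
import Literature.AlgebraicGeometry.HodgeTheory.WeilClassesRealSelfCup
import Literature.AlgebraicGeometry.HodgeTheory.WeilClassesFourfolds
import Literature.AlgebraicGeometry.HodgeTheory.WeilEigenlinesIsogenyTransport
import Literature.AlgebraicGeometry.HodgeTheory.WeilClassesBlochSeed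
import Literature.AlgebraicGeometry.HodgeTheory.WeilClassesCyclicPrymOneClass
import HarnessLib

/-!
# `SplitImpliesAll` — TYPE-II MEMBERS of every Weil cell `(ℚ(√-d), 2n, δ)`: the CM point of the type-II locus and its
anti-compatible anchor class (Part A of the type-II pointedness file; §0–§3)

SUPPORT file for item stmt-HodgeConjecture-19149 (`SplitImpliesAll.NonsplitSixfoldCells`, K1), authored by the cell typer
vhodge-typer-1 g0 (staged bytes `memos/TYPER1-SplitImpliesAllTypeIIPointedOfJ1.lean`, sha16 1a6cf2258863e468) and split in two by
the filing seat (vhodge P3 g18) to meet the 400-line rule for Theorems files; Part B is `Theorems/SplitImpliesAllTypeIIPointedOfJ1`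
(§4–§5: type-II pointedness (P) of every cell modulo J1 and the exactness corollaries). This part is FACT-FREE (no J1): it
produces, in every right-sign cell, a polarized member of exact discriminant class `δ` carrying a non-zero rational `(n,n)` Weil
class AND an algebraic anti-compatible degree-two class `y` with `y^{⌣2n} ≠ 0` (`exists_typeIIMember`) — the data of
`SplitImpliesAllTypeIIAnchorGerm.antiCompatibleAnchor n d` on the identity chart — and transports that data along `K`-isogenies.

## The argument (memo ROUTE-P3-g17 §3 (a), (d); the member is the CM point of the type-II locus, NOT its general member)

* §0 degree bookkeeping `y^{m+1} ≠ 0 ↔ Lᵐ_y y ≠ 0`.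
* §1 THE ANCHOR CLASS ON THE CM SQUARE (`n = 1`). On `(E₀ × E₀, ψ₀ × (-ψ₀))`, `ψ₀² = -d`, the rational Weil class
  `y₁ = u₊ + u₋ ∈ W_K ⊂ H²` is ALGEBRAIC (Schoen's shear divisors, tree `weilClassesPlus/Minus_cmSquare_le_algebraicClasses`),
  ANTI-COMPATIBLE (`φ^* = (√-d)² = -d` on `⋀²_K H¹`, tree `map_eq_smul_of_mem_weilClassesOf`) and has `y₁ ⌣ y₁ ≠ 0` (the rational
  Weil plane is anisotropic, tree `cupProduct_self_ne_zero_of_isRationalClass_of_mem_weilClassesOf`). [vanGeemen1994HodgeAV 5.3;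
  Schoen1998HodgeWeilAddendum §10]
* §2 THE CM TOWER WITH ITS ANCHOR CLASS. Ring 2's CM tower (`Ring2AbelianAllWeilCellsInhabited.exists_member`: every right-sign
  class `δ` is the discriminant class of a product of CM squares with Segre weights, `det H` multiplicative) is re-run carrying
  the class `y = Σ prᵢ^* y₁`: algebraic (pull-backs along homomorphisms, sums), anti-compatible (`(φ × ψ)^* prᵢ^* = prᵢ^* φᵢ^*`),
  rational, of non-zero top power (`(pr_A^* y_A + pr_B^* y_B)^{2n+2} = C(2n+2, 2n)·y_A^{2n} ⊠ y_B² ≠ 0`, the tree's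
  `lefschetzPow_add_map_self` + Künneth). So EVERY right-sign cell `(n, d, δ)` contains a member `E₀ⁿ × Ē₀ⁿ` carrying an algebraic
  anti-compatible class with `y^{2n} ≠ 0` — a CM point OF the type-II locus (ring-2 account TYPEII-ANCHOR-G22 §1.1 (a):
  `X × X̄ ∈ 𝔔(D)` for every `K`-threefold `X`, instance `X = E₀³`), NOT its general (simple) member.
* §3 TRANSPORT ALONG A `K`-ISOGENY `u : Y → B`, `u ∘ Ψ = φ_B ∘ u`: `u^* y` is algebraic, anti-compatible for `Ψ`, and
  `(u^* y)^{2n} = u^*(y^{2n}) ≠ 0` (`u^*` is bijective on `H^•`, tree `complexBetti_map_bijective_of_isIsogeny`).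

HONEST LABEL. No hypothesis in print is used here (J1 enters only in Part B); nothing here proves a case of the Hodge conjecture,
`W₆`, `HC_AV` or HC; `HC_CM` occurs nowhere; no new definition, no named fact, 0 sorries.

References: [vanGeemen1994HodgeAV] 4.9–4.14, Lemma 5.2, 5.3–5.5, 6.12; [Schoen1998HodgeWeilAddendum] §10;
[MoonenZarhin1998WeilClasses] §1–2; [LangeBirkenhake1992] §5.3; [MumfordAV1970] §19; [HatcherAT2002] §3.2; [Fulton1998] §19.2.
-/

set_option linter.dupNamespace false

open CategoryTheory AlgebraicGeometry Limits MonoidalCategory CartesianMonoidalCategory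
open Literature.AlgebraicGeometry Literature.AlgebraicGeometry.Motives
open Literature.AlgebraicGeometry.Motives.SegreHyperplaneClass
open Literature.AlgebraicGeometry.HodgeTheory
open Literature.AlgebraicGeometry.VanGeemen1994
open Literature.AlgebraicTopology.SingularHomology
open Literature.Geometry.Kaehler
open Summit.HodgeConjecture.HodgeConjecture.Ring2.Hypotheses
open Summit.HodgeConjecture.HodgeConjecture.Ring2.AbelianAll
open Summit.HodgeConjecture.HodgeConjecture.Theorems.SplitImpliesAllNonsplitCellsConnectedOfJ1
open Summit.HodgeConjecture.HodgeConjecture.Theorems.SplitImpliesAllTypeIIAnchorGerm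


namespace Summit.HodgeConjecture.HodgeConjecture.Theorems.SplitImpliesAllTypeIIMembers

/-! ## §0 Degree bookkeeping: `y^{m+1} ≠ 0 ↔ Lᵐ_y y ≠ 0` -/

/-- `y^{⌣(m+1)}` is the degree transport of `Lᵐ_y y = y^{⌣m} ⌣ y` (`2 + 2m = 2(m+1)`). [cite: HatcherAT2002, §3.2] -/
theorem cupPowTwo_succ_eq_degCast_lefschetzPow {X : SchemeOver ℂ} (y : complexBetti X 2) (m : ℕ) :
    cupPowTwo y (m + 1) = complexBetti.degCast X (by omega) (lefschetzPow y m 2 y) := by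
  rw [HodgeRiemannDegreeOne.lefschetzPow_self_eq_cupPowTwo, degCast_cupProduct, cupPowTwo_succ]

/-- `y^{⌣(m+1)} ≠ 0 ↔ Lᵐ_y y ≠ 0`. [cite: HatcherAT2002, §3.2] -/
theorem cupPowTwo_succ_ne_zero_iff {X : SchemeOver ℂ} (y : complexBetti X 2) (m : ℕ) :
    cupPowTwo y (m + 1) ≠ 0 ↔ lefschetzPow y m 2 y ≠ 0 := by
  rw [cupPowTwo_succ_eq_degCast_lefschetzPow, (complexBetti.degCast X _).map_ne_zero_iff]

/-! ## §1 The anchor class on the CM square -/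

/-- **The CM square carries an algebraic ANTI-COMPATIBLE class of non-zero square, in every discriminant class `[-m₁m₂]`.**
For `d ≥ 1`, weights `m₁, m₂ ≥ 1` and a Segre-additive rational family `g`: the abelian surface `(E₀ × E₀, ψ₀ × (-ψ₀))`
(`E₀ = ℂ/(ℤ + ℤ√-d)`), embedded with hyperplane class `pr₁^*(m₁η) + pr₂^*(m₂η)`, is of Weil type `(1, d)`, its `K`-symmetrised
hyperplane class has non-degenerate discriminant class `[-m₁m₂]` and non-zero square (ring 2, `exists_member_one`, re-run), AND
its rational Weil class `y₁ = u₊ + u₋` is algebraic (Schoen's shear divisors), anti-compatible (`φ^*y₁ = -d·y₁`) with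
`L¹_{y₁} y₁ = y₁ ⌣ y₁ ≠ 0`. [cite: vanGeemen1994HodgeAV, 4.9, 5.3 and Lemma 5.2 (2)–(6)] [cite: Schoen1998HodgeWeilAddendum, §10 (p. 333)]
[cite: Hartshorne1977, II Ex. 5.11 and Ex. 5.12] -/
theorem exists_member_one_antiCompatible (g : (N : ℕ) → complexBetti (projectiveSpace N ℂ) 2)
    (hgr : ∀ N : ℕ, IsRationalClass (g N)) (hgnz : ∀ N : ℕ, 1 ≤ N → g N ≠ 0)
    (hgσ : ∀ n m : ℕ, complexBetti.map (segreEmbedding n m ℂ) 2 (g (n * m + n + m)) =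
      complexBetti.map (CartesianMonoidalCategory.fst (projectiveSpace n ℂ) (projectiveSpace m ℂ)) 2 (g n) +
        complexBetti.map (CartesianMonoidalCategory.snd (projectiveSpace n ℂ) (projectiveSpace m ℂ)) 2 (g m))
    {d : ℕ} (hd : 0 < d) {m₁ m₂ : ℕ} (hm₁ : 0 < m₁) (hm₂ : 0 < m₂) (h0 : ((m₁ : ℚ) * m₂) ≠ 0) :
    ∃ (A : AbelianVariety ℂ) (φ : A ⟶ A) (e : ProjectiveEmbedding A.X), IsWeilType A φ 1 d ∧ 1 ≤ e.n ∧
      HasWeilDiscriminantNondeg A φ 1 d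
          ((d : ℂ) • complexBetti.map e.ι 2 (g e.n) + complexBetti.map φ.hom.hom.hom 2 (complexBetti.map e.ι 2 (g e.n)))
          (QuotientGroup.mk (-(Units.mk0 ((m₁ : ℚ) * m₂) h0))) ∧
      lefschetzPow ((d : ℂ) • complexBetti.map e.ι 2 (g e.n) + complexBetti.map φ.hom.hom.hom 2 (complexBetti.map e.ι 2 (g e.n)))
          (2 * 1 - 1) 2
        ((d : ℂ) • complexBetti.map e.ι 2 (g e.n) + complexBetti.map φ.hom.hom.hom 2 (complexBetti.map e.ι 2 (g e.n))) ≠ 0 ∧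
      ∃ y : complexBetti A.X 2, IsRationalClass y ∧ y ∈ algebraicClasses A.X 1 ∧
        complexBetti.map φ.hom.hom.hom 2 y = -((d : ℂ) • y) ∧ lefschetzPow y (2 * 1 - 1) 2 y ≠ 0 := by
  obtain ⟨E₀, ψ₀, hE, hψ⟩ := Literature.NumberTheory.EllipticCurves.CMEndomorphism.exists_cmCurve_sqrt_neg d hd
  obtain ⟨M, f₀, e, hM, hen, hecl⟩ := exists_projectiveEmbedding_cmSquare g hgσ E₀ hm₁ hm₂
  obtain ⟨hBdim, -, hΨ, up, um, hup, hum, hrat, hH, hup0, -⟩ := exists_weilType_cmSquare hE hd hψ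
  -- the rational Weil class `y₁ = u₊ + u₋` is non-zero, and the square is of Weil type `(1, d)`
  have hdis := disjoint_weilClassesPlus_weilClassesMinus (A := E₀.prod E₀)
    (φ := AbelianVariety.prodLift (AbelianVariety.fst E₀ E₀ ≫ ψ₀) (AbelianVariety.snd E₀ E₀ ≫ (-ψ₀))) one_pos hd
  have hc0 : up + um ≠ 0 := by
    intro h
    have hup' : up ∈ weilClassesMinus (E₀.prod E₀)
        (AbelianVariety.prodLift (AbelianVariety.fst E₀ E₀ ≫ ψ₀) (AbelianVariety.snd E₀ E₀ ≫ (-ψ₀))) 1 d := by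
      rw [eq_neg_of_add_eq_zero_left h]; exact Submodule.neg_mem _ hum
    exact hup0 (Submodule.disjoint_def.1 hdis up hup hup')
  have hyW : up + um ∈ weilClassesOf (E₀.prod E₀)
      (AbelianVariety.prodLift (AbelianVariety.fst E₀ E₀ ≫ ψ₀) (AbelianVariety.snd E₀ E₀ ≫ (-ψ₀))) 1 d :=
    Submodule.add_mem _ (weilClassesPlus_le_weilClassesOf _ _ 1 d hup) (weilClassesMinus_le_weilClassesOf _ _ 1 d hum)
  have hW : IsWeilType (E₀.prod E₀)
      (AbelianVariety.prodLift (AbelianVariety.fst E₀ E₀ ≫ ψ₀) (AbelianVariety.snd E₀ E₀ ≫ (-ψ₀))) 1 d :=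
    isWeilType_of_weilClass_ne_zero one_pos hd hBdim hΨ hyW hc0 hH
  -- `η = f₀^* g_M` is rational and non-zero (else `h_K = 0`, contradicting non-degeneracy, Lemma 5.2 (1))
  have hηr : IsRationalClass (complexBetti.map f₀ 2 (g M)) := (hgr M).pullback (AlgPoints.mapContinuous (L := ℂ) f₀)
  have hη0 : complexBetti.map f₀ 2 (g M) ≠ 0 := by
    intro h0'
    obtain ⟨δ, hδ⟩ := exists_hasWeilDiscriminantNondeg one_pos hBdim hd hΨ e (hgr _) (hgnz _ hen)
    have hcl : complexBetti.map e.ι 2 (g e.n) = 0 := by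
      rw [hecl, h0', smul_zero, smul_zero, map_zero, map_zero, add_zero]
    rw [hcl, map_zero, smul_zero, add_zero] at hδ
    exact not_hasWeilDiscriminantNondeg_zero one_pos δ hδ
  -- `(±√-d)^* = d` on `H²(E₀)`
  have h2 : ∀ x : complexBetti E₀.X 2, complexBetti.map ψ₀.hom.hom.hom 2 x = (d : ℂ) • x :=
    fun x => cmCurve_map_two hE hd hψ x
  have hψ' : (-ψ₀) ≫ (-ψ₀) = -(d • 𝟙 E₀) := by rw [Preadditive.neg_comp_neg]; exact hψ
  have h2' : ∀ x : complexBetti E₀.X 2, complexBetti.map (-ψ₀).hom.hom.hom 2 x = (d : ℂ) • x :=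
    fun x => cmCurve_map_two hE hd hψ' x
  have hs₁ : ((2 * d * m₁ : ℕ) : ℚ) ≠ 0 := by positivity
  have hs₂ : ((2 * d * m₂ : ℕ) : ℚ) ≠ 0 := by positivity
  -- `h_K = pr₁^*(2dm₁ η) + pr₂^*(2dm₂ η)`
  have hK : (d : ℂ) • complexBetti.map e.ι 2 (g e.n) +
      complexBetti.map (AbelianVariety.prodLift (AbelianVariety.fst E₀ E₀ ≫ ψ₀)
        (AbelianVariety.snd E₀ E₀ ≫ (-ψ₀))).hom.hom.hom 2 (complexBetti.map e.ι 2 (g e.n)) =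
      complexBetti.map (AbelianVariety.fst E₀ E₀).hom.hom.hom 2
          ((((2 * d * m₁ : ℕ) : ℚ) : ℂ) • complexBetti.map f₀ 2 (g M)) +
        complexBetti.map (AbelianVariety.snd E₀ E₀).hom.hom.hom 2
          ((((2 * d * m₂ : ℕ) : ℚ) : ℂ) • complexBetti.map f₀ 2 (g M)) := by
    have e₁ : (d : ℂ) * ((m₁ : ℕ) : ℂ) + (d : ℂ) * ((m₁ : ℕ) : ℂ) = (((2 * d * m₁ : ℕ) : ℚ) : ℂ) := by
      push_cast; ring
    have e₂ : (d : ℂ) * ((m₂ : ℕ) : ℂ) + (d : ℂ) * ((m₂ : ℕ) : ℂ) = (((2 * d * m₂ : ℕ) : ℚ) : ℂ) := by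
      push_cast; ring
    rw [hecl, smul_add_map_prodLift, h2, h2', smul_smul, ← add_smul, e₁, smul_smul, ← add_smul, e₂]
  obtain ⟨hN, htop⟩ := hasWeilDiscriminantNondeg_cmSquare hE hd hψ hηr hη0 hs₁ hs₂
  have hδ : (QuotientGroup.mk (-(Units.mk0 _ hs₁ * Units.mk0 _ hs₂)) : weilNormResidueGroup d) =
      QuotientGroup.mk (-(Units.mk0 ((m₁ : ℚ) * m₂) h0)) := by
    rw [← mk_pow_two_mul_pow_mul d (Units.mk0 ((2 * d : ℕ) : ℚ) (by positivity))
      (-(Units.mk0 ((m₁ : ℚ) * m₂) h0)) 1]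
    congr 1
    ext
    simp only [Units.val_neg, Units.val_mul, Units.val_pow_eq_pow_val, Units.val_mk0]
    push_cast
    ring
  -- the anchor class `y₁ = u₊ + u₋`
  have hyalg : up + um ∈ algebraicClasses (E₀.prod E₀).X 1 :=
    Submodule.add_mem _ (weilClassesPlus_cmSquare_le_algebraicClasses hE hd hψ hup)
      (weilClassesMinus_cmSquare_le_algebraicClasses hE hd hψ hum)
  have hyanti : complexBetti.map (AbelianVariety.prodLift (AbelianVariety.fst E₀ E₀ ≫ ψ₀)
      (AbelianVariety.snd E₀ E₀ ≫ (-ψ₀))).hom.hom.hom 2 (up + um) = -((d : ℂ) • (up + um)) := by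
    have h := map_eq_smul_of_mem_weilClassesOf hyW
    rw [pow_one, neg_smul] at h
    exact h
  have hytop : lefschetzPow (up + um) (2 * 1 - 1) 2 (up + um) ≠ 0 := by
    rw [HodgeRiemannDegreeOne.lefschetzPow_self_eq_cupPowTwo, cupPowTwo_one]
    exact cupProduct_self_ne_zero_of_isRationalClass_of_mem_weilClassesOf hBdim one_pos hd hΨ hyW hrat hc0 _
  refine ⟨E₀.prod E₀, _, e, hW, hen, ?_, ?_, up + um, hrat, hyalg, hyanti, hytop⟩
  · rw [hK, ← hδ]; exact hN
  · rw [hK]; exact htop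

/-! ## §2 The CM tower with its anchor class -/

/-- **The anchor class survives the product step.** For `y_A` on `A` (`dim A = 2n_A`) and `y_B` on `B` (`dim B = 2n_B`),
rational, algebraic, anti-compatible for `φ` resp. `ψ`, with `L^{2n_A-1} y_A ≠ 0`, `L^{2n_B-1} y_B ≠ 0`: the class
`y = pr_A^* y_A + pr_B^* y_B` on `(A × B, φ × ψ)` is rational, algebraic, anti-compatible, with `L^{2(n_A+n_B)-1}_y y ≠ 0`
(`= C(2n_A+2n_B, 2n_A)·d_A d_B · pr_A^*ω_A ⌣ pr_B^*ω_B`, Künneth). [cite: LangeBirkenhake1992, §5.3] [cite: HatcherAT2002, §3.2 Thm. 3.16]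
[cite: Fulton1998, §19.2 Cor. 19.2 (b)] -/
theorem antiCompatibleClass_prod {A B : AbelianVariety ℂ} {φ : A ⟶ A} {ψ : B ⟶ B} {nA nB d : ℕ}
    (hnA : 0 < nA) (hnB : 0 < nB) (hA : A.dim = 2 * nA) (hB : B.dim = 2 * nB)
    {yA : complexBetti A.X 2} {yB : complexBetti B.X 2} (hrA : IsRationalClass yA) (hrB : IsRationalClass yB)
    (haA : yA ∈ algebraicClasses A.X 1) (haB : yB ∈ algebraicClasses B.X 1)
    (hcA : complexBetti.map φ.hom.hom.hom 2 yA = -((d : ℂ) • yA)) (hcB : complexBetti.map ψ.hom.hom.hom 2 yB = -((d : ℂ) • yB))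
    (htA : lefschetzPow yA (2 * nA - 1) 2 yA ≠ 0) (htB : lefschetzPow yB (2 * nB - 1) 2 yB ≠ 0) :
    IsRationalClass (complexBetti.map (AbelianVariety.fst A B).hom.hom.hom 2 yA +
        complexBetti.map (AbelianVariety.snd A B).hom.hom.hom 2 yB) ∧
      complexBetti.map (AbelianVariety.fst A B).hom.hom.hom 2 yA +
          complexBetti.map (AbelianVariety.snd A B).hom.hom.hom 2 yB ∈ algebraicClasses (A.prod B).X 1 ∧
      complexBetti.map (AbelianVariety.prodLift (AbelianVariety.fst A B ≫ φ) (AbelianVariety.snd A B ≫ ψ)).hom.hom.hom 2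
          (complexBetti.map (AbelianVariety.fst A B).hom.hom.hom 2 yA +
            complexBetti.map (AbelianVariety.snd A B).hom.hom.hom 2 yB) =
        -((d : ℂ) • (complexBetti.map (AbelianVariety.fst A B).hom.hom.hom 2 yA +
            complexBetti.map (AbelianVariety.snd A B).hom.hom.hom 2 yB)) ∧
      lefschetzPow (complexBetti.map (AbelianVariety.fst A B).hom.hom.hom 2 yA +
          complexBetti.map (AbelianVariety.snd A B).hom.hom.hom 2 yB) (2 * (nA + nB) - 1) 2
        (complexBetti.map (AbelianVariety.fst A B).hom.hom.hom 2 yA +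
          complexBetti.map (AbelianVariety.snd A B).hom.hom.hom 2 yB) ≠ 0 := by
  have hAdim : A.dim = 2 * nA - 1 + 1 := by omega
  have hBdim : B.dim = 2 * nB - 1 + 1 := by omega
  have hm : 2 * (nA + nB) - 1 = (2 * nA - 1) + (2 * nB - 1) + 1 := by omega
  have hX : IsSmoothProjective (2 * nA - 1 + 1) A.X := isSmoothProjective_of_dim_eq' hAdim
  have hY : IsSmoothProjective (2 * nB - 1 + 1) B.X := isSmoothProjective_of_dim_eq' hBdim
  refine ⟨(hrA.map _).add (hrB.map _), Submodule.add_mem _ (map_mem_algebraicClasses_of_hom _ haA)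
    (map_mem_algebraicClasses_of_hom _ haB), ?_, ?_⟩
  · rw [map_add, map_prodLift_map_fst, map_prodLift_map_snd, hcA, hcB, map_neg, map_smul, map_neg, map_smul, smul_add,
      neg_add]
  · -- reference top classes `ω_A`, `ω_B` and the rational coordinates `d_A`, `d_B` of `y_A^{2n_A}`, `y_B^{2n_B}`
    obtain ⟨ωA, hωA, hωA0⟩ := exists_isRationalClass_ne_zero_two_add_two_mul hX
    obtain ⟨ωB, hωB, hωB0⟩ := exists_isRationalClass_ne_zero_two_add_two_mul hY
    obtain ⟨dA, hdA⟩ := exists_eq_ratCast_smul_of_finrank_eq_one (Motives.finrank_complexBetti_two_add_two_mul_eq_one hX)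
      hωA hωA0 (HodgeRiemannDegreeOne.IsRationalClass.lefschetzPow hrA (2 * nA - 1) hrA)
    obtain ⟨dB, hdB⟩ := exists_eq_ratCast_smul_of_finrank_eq_one (Motives.finrank_complexBetti_two_add_two_mul_eq_one hY)
      hωB hωB0 (HodgeRiemannDegreeOne.IsRationalClass.lefschetzPow hrB (2 * nB - 1) hrB)
    have hdA0 : dA ≠ 0 := by rintro rfl; exact htA (by rw [hdA, Rat.cast_zero, zero_smul])
    have hdB0 : dB ≠ 0 := by rintro rfl; exact htB (by rw [hdB, Rat.cast_zero, zero_smul])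
    have hω0 : cupProduct (by omega : (2 + 2 * (2 * nA - 1)) + (2 + 2 * (2 * nB - 1)) = 2 + 2 * (2 * (nA + nB) - 1))
        (complexBetti.map (AbelianVariety.fst A B).hom.hom.hom (2 + 2 * (2 * nA - 1)) ωA)
        (complexBetti.map (AbelianVariety.snd A B).hom.hom.hom (2 + 2 * (2 * nB - 1)) ωB) ≠ 0 :=
      cupProduct_map_fst_map_snd_ne_zero_of_add_eq hX hY _ (by omega) hωA0 hωB0
    rw [lefschetzPow_add_map_self hAdim hBdim hm yA ωA dA hdA yB ωB dB hdB]
    refine smul_ne_zero ?_ hω0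
    exact_mod_cast mul_ne_zero (mul_ne_zero (Nat.cast_ne_zero.2 (Nat.choose_pos (by omega)).ne') hdA0) hdB0

/-- **THE CM TOWER WITH ITS ANCHOR CLASS** (ring 2's `exists_member`, re-run carrying `y`): for every `n ≥ 1`, `d ≥ 1` and
every class `δ` with `sign δ = (-1)ⁿ` there is an embedded Weil-type pair `(A, φ, e)` of type `(n, d)` — a product of CM squares,
`≅ E₀ⁿ × Ē₀ⁿ` — whose `K`-symmetrised hyperplane class has non-degenerate discriminant class `δ` and non-zero top power, AND
which carries a rational ALGEBRAIC ANTI-COMPATIBLE degree-two class `y` (`φ^*y = -d·y`) with `L^{2n-1}_y y = y^{2n} ≠ 0`: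
a CM point of the type-II locus of the cell. [cite: vanGeemen1994HodgeAV, 4.11, 4.14, Lemma 5.2 (3) and 5.3]
[cite: Schoen1998HodgeWeilAddendum, §10] [cite: Shimura1963AnalyticFamilies, §4] -/
theorem exists_member_antiCompatible (g : (N : ℕ) → complexBetti (projectiveSpace N ℂ) 2)
    (hgr : ∀ N : ℕ, IsRationalClass (g N)) (hgnz : ∀ N : ℕ, 1 ≤ N → g N ≠ 0)
    (hgσ : ∀ n m : ℕ, complexBetti.map (segreEmbedding n m ℂ) 2 (g (n * m + n + m)) =
      complexBetti.map (CartesianMonoidalCategory.fst (projectiveSpace n ℂ) (projectiveSpace m ℂ)) 2 (g n) +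
        complexBetti.map (CartesianMonoidalCategory.snd (projectiveSpace n ℂ) (projectiveSpace m ℂ)) 2 (g m))
    {n d : ℕ} (hn : 1 ≤ n) (hd : 0 < d) {δ : weilNormResidueGroup d} (hδ : weilSign d δ = (-1) ^ n) :
    ∃ (A : AbelianVariety ℂ) (φ : A ⟶ A) (e : ProjectiveEmbedding A.X), IsWeilType A φ n d ∧ 1 ≤ e.n ∧
      HasWeilDiscriminantNondeg A φ n d
          ((d : ℂ) • complexBetti.map e.ι 2 (g e.n) + complexBetti.map φ.hom.hom.hom 2 (complexBetti.map e.ι 2 (g e.n)))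
          δ ∧
      lefschetzPow ((d : ℂ) • complexBetti.map e.ι 2 (g e.n) + complexBetti.map φ.hom.hom.hom 2 (complexBetti.map e.ι 2 (g e.n)))
          (2 * n - 1) 2
        ((d : ℂ) • complexBetti.map e.ι 2 (g e.n) + complexBetti.map φ.hom.hom.hom 2 (complexBetti.map e.ι 2 (g e.n))) ≠ 0 ∧
      ∃ y : complexBetti A.X 2, IsRationalClass y ∧ y ∈ algebraicClasses A.X 1 ∧
        complexBetti.map φ.hom.hom.hom 2 y = -((d : ℂ) • y) ∧ lefschetzPow y (2 * n - 1) 2 y ≠ 0 := by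
  induction n, hn using Nat.le_induction generalizing δ with
  | base =>
    obtain ⟨q, rfl⟩ := QuotientGroup.mk_surjective δ
    rw [show ((-1 : ℤˣ) ^ (1 : ℕ)) = -1 from pow_one _, weilSign_mk, ratSign_eq_neg_one_iff] at hδ
    obtain ⟨a, b, ha, hb, hab⟩ := exists_mk_neg_natCast_mul_eq d q hδ
    have h0 : ((a : ℚ) * b) ≠ 0 := by positivity
    rw [← hab h0]
    exact exists_member_one_antiCompatible g hgr hgnz hgσ hd ha hb h0
  | succ n hn IH =>
    have h11 : (((1 : ℕ) : ℚ) * (1 : ℕ)) ≠ 0 := by norm_num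
    have hneg : ((-(Units.mk0 _ h11) : ℚˣ) : ℚ) < 0 := by simp
    have hδ' : weilSign d (δ * QuotientGroup.mk (-(Units.mk0 _ h11))) = (-1) ^ n := by
      rw [map_mul, hδ, weilSign_mk_of_neg d hneg, show ((-1 : ℤˣ) ^ (n + 1 : ℕ)) = (-1) ^ (n : ℕ) * (-1) from pow_succ _ _,
        mul_assoc, show ((-1 : ℤˣ) * -1) = 1 from by simp, mul_one]
    obtain ⟨A, φ, eA, hWA, heA, hNA, htA, yA, hyAr, hyAa, hyAc, hyAt⟩ := IH hδ'
    obtain ⟨B, ψ, eB, hWB, heB, hNB, htB, yB, hyBr, hyBa, hyBc, hyBt⟩ :=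
      exists_member_one_antiCompatible g hgr hgnz hgσ hd one_pos one_pos h11
    obtain ⟨e, hen, hecl⟩ := exists_projectiveEmbedding_prod g hgσ eA eB
    obtain ⟨hP, htP⟩ := hasWeilDiscriminantNondeg_prod hWA.pos hWB.pos hWA.dim_eq hWB.dim_eq
      (isRationalClass_ksymm d φ eA (hgr _)) (isRationalClass_ksymm d ψ eB (hgr _)) htA htB hNA hNB
    obtain ⟨hyr, hya, hyc, hyt⟩ := antiCompatibleClass_prod hWA.pos hWB.pos hWA.dim_eq hWB.dim_eq hyAr hyBr hyAa hyBa
      hyAc hyBc hyAt hyBt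
    have hK : (d : ℂ) • complexBetti.map e.ι 2 (g e.n) +
        complexBetti.map (AbelianVariety.prodLift (AbelianVariety.fst A B ≫ φ)
          (AbelianVariety.snd A B ≫ ψ)).hom.hom.hom 2 (complexBetti.map e.ι 2 (g e.n)) =
        complexBetti.map (AbelianVariety.fst A B).hom.hom.hom 2
            ((d : ℂ) • complexBetti.map eA.ι 2 (g eA.n) + complexBetti.map φ.hom.hom.hom 2 (complexBetti.map eA.ι 2 (g eA.n))) +
          complexBetti.map (AbelianVariety.snd A B).hom.hom.hom 2
            ((d : ℂ) • complexBetti.map eB.ι 2 (g eB.n) + complexBetti.map ψ.hom.hom.hom 2 (complexBetti.map eB.ι 2 (g eB.n))) := by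
      rw [hecl]; exact smul_add_map_prodLift φ ψ (d : ℂ) _ _
    have hxx : (-(Units.mk0 _ h11) : ℚˣ) * -(Units.mk0 _ h11) = 1 := by ext; simp
    have hmul : δ * QuotientGroup.mk (-(Units.mk0 _ h11)) * QuotientGroup.mk (-(Units.mk0 _ h11)) = δ := by
      rw [mul_assoc, ← QuotientGroup.mk_mul, hxx, QuotientGroup.mk_one, mul_one]
    refine ⟨A.prod B, _, e, isWeilType_prod hWA hWB, le_trans heB hen, ?_, ?_, _, hyr, hya, hyc, hyt⟩
    · rw [hK, ← hmul]; exact hP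
    · rw [hK]; exact htP

/-- **Every right-sign cell `(n, d, δ)` contains a polarized member of exact class `δ` carrying a non-zero rational `(n,n)` Weil
class AND an algebraic anti-compatible degree-two class `y` with `y^{⌣2n} ≠ 0`** — the shape reached by the cell's package
(`CellSystemReachAt`, last clause) together with the data of `antiCompatibleAnchor n d` on the identity chart.
[cite: vanGeemen1994HodgeAV, 4.11, 4.14 and Lemma 5.2] [cite: MoonenZarhin1998WeilClasses, §2] -/
theorem exists_typeIIMember {n d : ℕ} (hn : 0 < n) (hd : 0 < d) {δ : weilNormResidueGroup d}
    (hδ : weilSign d δ = (-1) ^ n) :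
    ∃ (B : AbelianVariety ℂ) (φB : B ⟶ B) (eB : ProjectiveEmbedding B.X) (aB : complexBetti (projectiveSpace eB.n ℂ) 2),
      B.dim = 2 * n ∧ φB ≫ φB = -(d • 𝟙 B) ∧ IsRationalClass aB ∧ aB ≠ 0 ∧
      (∃ c ∈ weilClassesOf B φB n d, c ≠ 0 ∧ IsOfHodgeType (2 * n) B.X (2 * n) n n c) ∧
      HasWeilDiscriminantNondeg B φB n d (kSymmClass B φB d eB aB) δ ∧
      ∃ y : complexBetti B.X 2, y ∈ algebraicClasses B.X 1 ∧
        complexBetti.map φB.hom.hom.hom 2 y = -((d : ℂ) • y) ∧ cupPowTwo y (2 * n) ≠ 0 := by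
  obtain ⟨g, hgr, hgnz, hgσ⟩ := exists_segreHyperplaneClasses
  obtain ⟨B, φB, eB, hWB, hen, hNB, -, y, -, hya, hyc, hyt⟩ := exists_member_antiCompatible g hgr hgnz hgσ hn hd hδ
  obtain ⟨wB, hwBW, -, hwBH, hwB0⟩ := exists_weilClass_of_isWeilType hWB
  refine ⟨B, φB, eB, g eB.n, hWB.dim_eq, hWB.sq_eq, hgr _, hgnz _ hen, ⟨wB, hwBW, hwB0, hwBH⟩, hNB, y, hya, hyc, ?_⟩
  have h2n : 2 * n = (2 * n - 1) + 1 := by omega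
  rw [h2n, cupPowTwo_succ_ne_zero_iff]
  exact hyt

/-! ## §3 Transport of the anchor class along a `K`-isogeny -/

/-- **An algebraic anti-compatible class of non-zero top power pulls back along a `K`-linear isogeny** `u : Y ⟶ B`,
`u ≫ φ_B = Ψ ≫ u`: `u^*y` is algebraic (pull-back along a homomorphism), `Ψ^*(u^*y) = (Ψ ≫ u)^*y = (u ≫ φ_B)^*y = -d·u^*y`, and
`(u^*y)^{2n} = u^*(y^{2n}) ≠ 0` since `u^*` is injective on `H^{4n}` (isogenies induce isomorphisms on rational cohomology).
[cite: MumfordAV1970, §19 Remark p. 169] [cite: vanGeemen1994HodgeAV, 3.6–3.7] [cite: Fulton1998, §19.2 Cor. 19.2 (b)] -/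
theorem antiCompatibleClass_map_of_isIsogeny {Y B : AbelianVariety ℂ} {Ψ : Y ⟶ Y} {φB : B ⟶ B} {u : Y ⟶ B}
    (hu : AbelianVariety.IsIsogeny u) (hcomm : u ≫ φB = Ψ ≫ u) {n d : ℕ} {y : complexBetti B.X 2}
    (hya : y ∈ algebraicClasses B.X 1) (hyc : complexBetti.map φB.hom.hom.hom 2 y = -((d : ℂ) • y))
    (hyt : cupPowTwo y (2 * n) ≠ 0) :
    complexBetti.map u.hom.hom.hom 2 y ∈ algebraicClasses Y.X 1 ∧
      complexBetti.map Ψ.hom.hom.hom 2 (complexBetti.map u.hom.hom.hom 2 y) = -((d : ℂ) • complexBetti.map u.hom.hom.hom 2 y) ∧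
      cupPowTwo (complexBetti.map u.hom.hom.hom 2 y) (2 * n) ≠ 0 := by
  refine ⟨map_mem_algebraicClasses_of_hom u hya, ?_, ?_⟩
  · rw [complexBetti_map_map_hom, ← hcomm, ← complexBetti_map_map_hom, hyc, map_neg, map_smul]
  · rw [← complexBetti_map_cupPowTwo']
    intro h0
    exact hyt ((complexBetti_map_bijective_of_isIsogeny hu (2 * (2 * n))).1 (by rw [h0, map_zero]))

end Summit.HodgeConjecture.HodgeConjecture.Theorems.SplitImpliesAllTypeIIMembers
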